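import Summits.BirchSwinnertonDyer.BirchSwinnertonDyer.Theorems.RamifiedHeegnerPairLeafPartnerOrdersUTwist
import HarnessLib

/-!
# Route `RamifiedHeegnerPair`, crux U₁ `LeafRankOneUpperAtThree` (stmt-BirchSwinnertonDyer-26022), line `partnerdescent` —
# the DICT stub loses a conjunct: **Hecke stability of Ribet's lattice `Y` is a THEOREM of saturation + the new-projector + (HT)**

HONEST FRAMING. Theorems only; helper file (`--supports stmt-BirchSwinnertonDyer-26022`); elementary module algebra over the tree's Brandt
layer (‹BrandtEichlerLevelUOperators› `XiSetup.heckeAt`, `XiSetup.fullHeckeAlgebra`; ‹…Commute› `XiSetup.fullHeckeAlgebra_comm`) and (HT)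
‹…LeafPartnerOrdersUTwist› `heckeTwist` (lead g65: every `S.heckeAt q` preserves degree zero); no number theory, no named fact, no `sorry`;
nothing booked; BSD is proved for no curve. Lead prover bsd-line-rhp-p2 g66, 2026-08-31 (executing memo LEAD-G65-HECKETWIST §5).

WHY. The stub DICT `Partnerdescent.LeafHeckeDictionaryAtThree` of skeleton v11 (= `hDICT` of ‹…CanonicalGenerators›
`cokernelFifth_of_canonicalInputs`) carries, next to Ribet's ∕ Takahashi's dictionary (`Y`, `π^*`, `π_*`, adjointness, saturation,
multiplicity one of the `a(W′)`-line), the new-projector (C2′) `u_Y ∈ 𝕋_{pM,d}(S)`, `u_Y|_Y = N₀ ≠ 0`, `u_Y B ⊆ Y`, and (C5′), the clause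
«`Y` is stable under every `S.heckeAt q`». That clause is NOT an input: for `y ∈ Y ≤ B` and `T = S.heckeAt q` one has `T y ∈ B` ((HT):
column sums), `N₀ • (T y) = T (u_Y y) = u_Y (T y) ∈ u_Y B ⊆ Y` (`𝕋_{pM,d}(S)` is commutative), and `Y` is saturated with `N₀ ≠ 0`, so
`T y ∈ Y`. Hence the next skeleton (v12 ∕ v25) files DICT WITHOUT the stability clause (DICT♭, one print conjunct fewer, monotone) and
recovers DICT by `leafHeckeDictionary_of_reduced` below.

WHAT.
* §1 `mulVec_mem_of_saturated_of_projector` — the abstract glue: a saturated `Y ≤ B`, an operator `u` with `u|_Y = N₀ ≠ 0`, `u B ⊆ Y`,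
  and `T` preserving `B` and commuting with `u` ⟹ `T Y ⊆ Y`.
* §2 `heckeAt_mulVec_mem_of_projector` — for a Brandt setup `S`: `Y` saturated, `Y ≤ B = ` degree zero, `u_Y ∈ 𝕋_{N⁺,N⁻}(S)` as above ⟹
  `S.heckeAt q *ᵥ y ∈ Y` for every prime `q` and `y ∈ Y`.
* §3 `leafHeckeDictionary_of_reduced` — DICT♭ ⟹ DICT, both with the stub's binders VERBATIM (the Cruxes work file is not importable; the
  skeleton predicates unfold to these bodies definitionally).
[cite: Ribet1990, Prop. 3.1, Thm. 4.1 (Hecke-equivariance of the exact sequence)] [cite: WZhang2014, §3.9 p. 214] [cite: Takahashi2001, Prop. 3.1, Thm. 3.2 (a)]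
-/

set_option linter.dupNamespace false
set_option autoImplicit false

noncomputable section

namespace Summit.BirchSwinnertonDyer.BirchSwinnertonDyer.Theorems.LeafPartnerOrders

open scoped Pointwise Matrix
open Matrix Literature.NumberTheory.Automorphic Literature.NumberTheory.Automorphic.Brandt Literature.NumberTheory.EllipticCurves

/-! ### §1 The abstract glue -/

/-- **Saturation + a projector with non-zero scalar ⟹ stability.** Let `Y ≤ B` be submodules of `ℤ^ι` with `Y` saturated, `u` an
integer matrix with `u y = N₀ y` on `Y` (`N₀ ≠ 0`) and `u B ⊆ Y`, and `T` a matrix preserving `B` and commuting with `u`. Then `T Y ⊆ Y`: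
`N₀ (T y) = T (u y) = u (T y) ∈ Y`. [folklore] -/
theorem mulVec_mem_of_saturated_of_projector {ι : Type*} [Fintype ι]
    {Y B : Submodule ℤ (ι → ℤ)} {T u : Matrix ι ι ℤ} {N₀ : ℤ}
    (hYsat : ∀ (k : ℤ) (v : ι → ℤ), k ≠ 0 → k • v ∈ Y → v ∈ Y) (hYB : Y ≤ B)
    (hTB : ∀ b ∈ B, T *ᵥ b ∈ B) (hcomm : T * u = u * T) (hN₀ : N₀ ≠ 0)
    (huY : ∀ y ∈ Y, u *ᵥ y = N₀ • y) (huB : ∀ b ∈ B, u *ᵥ b ∈ Y)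
    {y : ι → ℤ} (hy : y ∈ Y) : T *ᵥ y ∈ Y := by
  refine hYsat N₀ (T *ᵥ y) hN₀ ?_
  have h : N₀ • (T *ᵥ y) = u *ᵥ (T *ᵥ y) := by
    rw [← mulVec_smul, ← huY y hy, mulVec_mulVec, mulVec_mulVec, hcomm]
  rw [h]
  exact huB _ (hTB y (hYB hy))

/-! ### §2 Hecke stability in a Brandt setup -/

variable {Nplus Nminus : ℕ} (S : XiSetup Nplus Nminus)

open scoped Classical in
/-- **Hecke stability of a saturated degree-zero lattice carrying a new-projector.** For a Brandt setup `S`, a saturated `Y` inside the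
degree-zero lattice `B`, and `u_Y ∈ 𝕋_{N⁺,N⁻}(S)` with `u_Y|_Y = N₀ ≠ 0`, `u_Y B ⊆ Y`: every `S.heckeAt q` (`q` prime) maps `Y` into `Y` —
by §1, since `S.heckeAt q ∈ 𝕋_{N⁺,N⁻}(S)` commutes with `u_Y` (`XiSetup.fullHeckeAlgebra_comm`) and preserves degree zero (`heckeTwist`,
last conjunct: column sums of `T(q)` and of `U_ℓ`). [cite: Ribet1990, Prop. 3.1, Thm. 4.1] [cite: WZhang2014, §3.9 p. 214] -/
theorem heckeAt_mulVec_mem_of_projector [Fintype (ClassSet S.O)]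
    {Y B : Submodule ℤ (ClassSet S.O → ℤ)} (hB : ∀ v, v ∈ B ↔ ∑ c, v c = 0)
    (hYsat : ∀ (k : ℤ) (v : ClassSet S.O → ℤ), k ≠ 0 → k • v ∈ Y → v ∈ Y) (hYB : Y ≤ B)
    {uY : Matrix (ClassSet S.O) (ClassSet S.O) ℤ} {N₀ : ℤ} (huYG : uY ∈ S.fullHeckeAlgebra) (hN₀ : N₀ ≠ 0)
    (huY : ∀ y ∈ Y, uY *ᵥ y = N₀ • y) (huYB : ∀ b ∈ B, uY *ᵥ b ∈ Y) :
    ∀ q : ℕ, q.Prime → ∀ y ∈ Y, S.heckeAt q *ᵥ y ∈ Y := by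
  intro q hq y hy
  obtain ⟨-, -, -, -, -, -, -, -, hdeg⟩ := heckeTwist S
  have hTB : ∀ b ∈ B, S.heckeAt q *ᵥ b ∈ B := fun b hb ↦ (hB _).mpr (hdeg q hq b ((hB b).mp hb))
  exact mulVec_mem_of_saturated_of_projector hYsat hYB hTB
    (S.fullHeckeAlgebra_comm (S.heckeAt_mem_fullHeckeAlgebra hq) huYG) hN₀ huY huYB hy

/-! ### §3 DICT♭ ⟹ DICT with the stub's binders -/

/-- **DICT♭ ⟹ DICT.** The stub text `Partnerdescent.LeafHeckeDictionaryAtThree` (skeleton v11; = `hDICT` of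
`cokernelFifth_of_canonicalInputs`) follows from the SAME text with the clause «`∀ q prime, ∀ y ∈ Y, S.heckeAt q *ᵥ y ∈ Y`» DELETED
(DICT♭, the v12 stub `Partnerdescent.LeafHeckeDictionaryReducedAtThree`): the deleted clause is `heckeAt_mulVec_mem_of_projector` applied to the
saturation, `Y ≤ B` and new-projector conjuncts. Both bodies VERBATIM. [cite: Ribet1990, Prop. 3.1, Thm. 4.1] [cite: Takahashi2001, Prop. 3.1, Thm. 3.2 (a)]
[cite: PapikianRabinoff2016, §3 ¶23, Lemma 24] -/
theorem leafHeckeDictionary_of_reduced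
    (hred : ∀ {N D M p d : ℕ}, p.Prime → D = p * d → IsAdmissibleFactorization N D M →
      ∀ (X : ShimuraCurveData D M) (W : WeierstrassCurve ℚ) [W.IsElliptic] [W.IsGloballyMinimal],
        W.conductorNorm ℤ = N → ¬ 3 ∣ N → W.HasIrreducibleModPGaloisRep 3 →
      ∀ [Fact d.Prime], d ≠ p → W.HasSplitMultiplicativeReductionAtPrime d →
      ∀ (W' : WeierstrassCurve ℚ) [W'.IsElliptic] (P : ShimuraParametrizationData X W'), P.IsMinimalFor W →
      ∀ (S : Brandt.XiSetup (p * M) d) [Fintype (ClassSet S.O)] [DecidableEq (ClassSet S.O)]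
        (B : Submodule ℤ (ClassSet S.O → ℤ)), (∀ v, v ∈ B ↔ ∑ c, v c = 0) →
      ∃ (Y : Submodule ℤ (ClassSet S.O → ℤ)) (pb : ℤ →ₗ[ℤ] Y) (pf : Y →ₗ[ℤ] ℤ)
        (uY : Matrix (ClassSet S.O) (ClassSet S.O) ℤ) (N₀ : ℤ),
        (∀ (a : ℤ) (y : Y), ∑ k, (weight S.O k : ℤ) * (pb a : ClassSet S.O → ℤ) k * (y : ClassSet S.O → ℤ) k =
          ((W'.minimalDiscriminantNorm ℤ).factorization p : ℤ) * a * pf y) ∧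
        (∀ a : ℤ, pf (pb a) = (P.deg : ℤ) * a) ∧ Function.Surjective pf ∧
        (∀ (k : ℤ) (v : ClassSet S.O → ℤ), k ≠ 0 → k • v ∈ Y → v ∈ Y) ∧
        Module.finrank ℤ (eigenLattice (p * M * d) (Brandt.matrix S.O) (fun n ↦ W'.LFunction n)) = 1 ∧
        (pb 1 : ClassSet S.O → ℤ) ∈ eigenLattice (p * M * d) (Brandt.matrix S.O) (fun n ↦ W'.LFunction n) ∧
        Y ≤ B ∧
        uY ∈ S.fullHeckeAlgebra ∧ N₀ ≠ 0 ∧ (∀ y ∈ Y, uY *ᵥ y = N₀ • y) ∧ (∀ b ∈ B, uY *ᵥ b ∈ Y) ∧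
        (∀ C ∈ S.fullHeckeAlgebra, ∀ a : ℤ,
          (∀ y (hy : y ∈ Y), (P.deg : ℤ) • (C *ᵥ y) = a • pf ⟨y, hy⟩ • (pb 1 : ClassSet S.O → ℤ)) → (P.deg : ℤ) ∣ a)) :
    ∀ {N D M p d : ℕ}, p.Prime → D = p * d → IsAdmissibleFactorization N D M →
      ∀ (X : ShimuraCurveData D M) (W : WeierstrassCurve ℚ) [W.IsElliptic] [W.IsGloballyMinimal],
        W.conductorNorm ℤ = N → ¬ 3 ∣ N → W.HasIrreducibleModPGaloisRep 3 →
      ∀ [Fact d.Prime], d ≠ p → W.HasSplitMultiplicativeReductionAtPrime d →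
      ∀ (W' : WeierstrassCurve ℚ) [W'.IsElliptic] (P : ShimuraParametrizationData X W'), P.IsMinimalFor W →
      ∀ (S : Brandt.XiSetup (p * M) d) [Fintype (ClassSet S.O)] [DecidableEq (ClassSet S.O)]
        (B : Submodule ℤ (ClassSet S.O → ℤ)), (∀ v, v ∈ B ↔ ∑ c, v c = 0) →
      ∃ (Y : Submodule ℤ (ClassSet S.O → ℤ)) (pb : ℤ →ₗ[ℤ] Y) (pf : Y →ₗ[ℤ] ℤ)
        (uY : Matrix (ClassSet S.O) (ClassSet S.O) ℤ) (N₀ : ℤ),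
        (∀ (a : ℤ) (y : Y), ∑ k, (weight S.O k : ℤ) * (pb a : ClassSet S.O → ℤ) k * (y : ClassSet S.O → ℤ) k =
          ((W'.minimalDiscriminantNorm ℤ).factorization p : ℤ) * a * pf y) ∧
        (∀ a : ℤ, pf (pb a) = (P.deg : ℤ) * a) ∧ Function.Surjective pf ∧
        (∀ (k : ℤ) (v : ClassSet S.O → ℤ), k ≠ 0 → k • v ∈ Y → v ∈ Y) ∧
        Module.finrank ℤ (eigenLattice (p * M * d) (Brandt.matrix S.O) (fun n ↦ W'.LFunction n)) = 1 ∧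
        (pb 1 : ClassSet S.O → ℤ) ∈ eigenLattice (p * M * d) (Brandt.matrix S.O) (fun n ↦ W'.LFunction n) ∧
        Y ≤ B ∧ (∀ q : ℕ, q.Prime → ∀ y ∈ Y, S.heckeAt q *ᵥ y ∈ Y) ∧
        uY ∈ S.fullHeckeAlgebra ∧ N₀ ≠ 0 ∧ (∀ y ∈ Y, uY *ᵥ y = N₀ • y) ∧ (∀ b ∈ B, uY *ᵥ b ∈ Y) ∧
        (∀ C ∈ S.fullHeckeAlgebra, ∀ a : ℤ,
          (∀ y (hy : y ∈ Y), (P.deg : ℤ) • (C *ᵥ y) = a • pf ⟨y, hy⟩ • (pb 1 : ClassSet S.O → ℤ)) → (P.deg : ℤ) ∣ a) := by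
  intro N D M p d hp hD hadm X W _ _ hN h3 hirr _ hdp hsplit W' _ P hP S _ _ B hB
  obtain ⟨Y, pb, pf, uY, N₀, hadjY, hδ, hsurj, hYsat, hrank, hmem, hYB, huYG, hN₀, huY, huYB, hC5⟩ :=
    hred hp hD hadm X W hN h3 hirr hdp hsplit W' P hP S B hB
  exact ⟨Y, pb, pf, uY, N₀, hadjY, hδ, hsurj, hYsat, hrank, hmem, hYB,
    heckeAt_mulVec_mem_of_projector S hB hYsat hYB huYG hN₀ huY huYB, huYG, hN₀, huY, huYB, hC5⟩

end Summit.BirchSwinnertonDyer.BirchSwinnertonDyer.Theorems.LeafPartnerOrders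

end
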